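import Summits.AtomisticToContinuum.FouriersLaw.Theorems.EmbeddedDrudeMourreDrudeDissolutionStubPencilFramework
import Summits.AtomisticToContinuum.FouriersLaw.Theorems.EmbeddedDrudeMourreDrudeDissolutionStubFreeForceKernelSpectral
import Summits.AtomisticToContinuum.FouriersLaw.Theorems.EmbeddedDrudeMourreDrudeDissolutionStubHarmonicStein
import Summits.AtomisticToContinuum.FouriersLaw.Theorems.EmbeddedDrudeMourreDrudeDissolutionStubWickShellStatic
import Summits.AtomisticToContinuum.FouriersLaw.Theorems.EmbeddedDrudeMourreDrudeDissolutionStubHarmonicPencilAlgebra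
import Summits.AtomisticToContinuum.FouriersLaw.Theorems.EmbeddedDrudeMourreDrudeDissolutionStubWickShellDynamic
import Summits.AtomisticToContinuum.FouriersLaw.Theorems.EmbeddedDrudeMourreDrudeDissolutionStubForceKernels
import Summits.AtomisticToContinuum.FouriersLaw.Theorems.EmbeddedDrudeMourreDrudeDissolutionStubForceWindow
import Literature.MathematicalPhysics.KineticTheory.ZeroWavenumberSpace
import Literature.MathematicalPhysics.KineticTheory.InfiniteChainInvariantStates
import Literature.MathematicalPhysics.KineticTheory.InfiniteChainSuperstableDynamics
import Literature.MathematicalPhysics.KineticTheory.InfiniteChainShiftInvariantUniqueness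
import Literature.MathematicalPhysics.KineticTheory.HarmonicHostWithCell
import Literature.MathematicalPhysics.KineticTheory.HarmonicChaosDecomposition
import HarnessLib

/-!
# The free Fermi-golden-rule kernel of the current — stub K of line `gram-pencil-harmonic-chaos` as a THEOREM
(crux `EmbeddedDrudeMourre.DrudeDissolution`, item stmt-AtomisticToContinuum-12593; `--supports` file; lead c11)

WHAT. `stub_freeForceKernel`: for `ω₂, a, b > 0` with `HasOddSectorGap ω₂ a b` and EVERY zero-wavenumber datum
`(D₀, Z₀)` of the harmonic chain `pinnedChain ω₂ 0 0 1` at `T = 1` (DLR state, carrier `bmGood`, strongly continuous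
fluctuation dynamics, the first-order force `Φ` of the pencil in `Z₀.localObs`), the Abel–Poisson cosine transforms
`∫₀^∞ e^{−νt} cos(ωt) Z₀.form Φ (Φ ∘ φ_t) dt` converge, as `ν ↓ 0`, locally uniformly on a window `(−δ, δ)` to `πρ`
with `ρ` continuous on the window and `ρ(0) > 0`.

HOW (the composition of the line's six K sub-stubs, all landed): reduce to the window-density clause
(`stub_freeForceKernel_of_windowDensity`); take the canonical datum of `stub_pencilFramework` at coupling `(0,0)`;
move the kernel of the given datum to it by RIGIDITY (`form_comp_flow_rigid`: the `T = 1` shift-invariant DLR state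
is unique and two flows with carrier `bmGood` agree a.e.); present `Φ` as a Wick polynomial (`stub_forceKernels`,
whose degree-2 chaos vector vanishes); evaluate `Z.form Φ (Φ ∘ φ_t) = Re⟪Ψ, e^{−itΩ}Ψ⟫` (`stub_wickShellDynamic`,
fed by `stub_wickShellStatic ∘ stub_harmonicStein` and `stub_harmonicPencilAlgebra`); `stub_forceWindow` supplies
the finite measure with that cosine transform and its window density, positive at `0`.
-/

noncomputable section

namespace Summit.AtomisticToContinuum.FouriersLaw.Theorems.DrudeDissolution.GramPencilHarmonicChaos

open MeasureTheory Filter Set Function Topology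
open scoped InnerProductSpace ENNReal ComplexConjugate
open Literature.MathematicalPhysics.KineticTheory
open Literature.MathematicalPhysics.KineticTheory.HeatConduction
open Literature.MathematicalPhysics.KineticTheory.PhononBoltzmann
open HarmonicChaos ProbabilityTheory
open PinnedChainKinetic (𝕋 𝕋3 μ𝕋 μ𝕋3 k₄ sinT)
open scoped Literature.MathematicalPhysics.KineticTheory.HeatConduction.PinnedChainKinetic

/-- **Rigidity of the free force kernel (lead c11).** Two zero-wavenumber data of the harmonic chain at `T = 1` over
dynamics with carrier `bmGood` have THE SAME autocorrelation functions on common observables: the state is the unique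
shift-invariant DLR state (`OscillatorChain.eq_of_isChainGibbsMeasure_of_isShiftInvariant_pinnedChain`) and the two flows agree on
`bmGood` (uniqueness field of `InfiniteChainDynamics`), a set of full measure. This is what lets stub K quantify over ALL data while
the computation (K6) runs on F's canonical datum. [folklore] -/
theorem form_comp_flow_rigid {ω₂ : ℝ} (hω : 0 < ω₂)
    {D₀ D : InfiniteChainDynamics (pinnedChain ω₂ 0 0 1)}
    (Z₀ : ZeroWavenumberData (pinnedChain ω₂ 0 0 1) D₀) (Z : ZeroWavenumberData (pinnedChain ω₂ 0 0 1) D)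
    (hG₀ : (pinnedChain ω₂ 0 0 1).IsChainGibbsMeasure 1 Z₀.μ) (hG : (pinnedChain ω₂ 0 0 1).IsChainGibbsMeasure 1 Z.μ)
    (hcar₀ : D₀.carrier = (pinnedChain ω₂ 0 0 1).bmGood) (hcar : D.carrier = (pinnedChain ω₂ 0 0 1).bmGood)
    {u : ChainConfig → ℝ} (hu₀ : u ∈ Z₀.localObs) (hu : u ∈ Z.localObs) (t : ℝ) :
    Z₀.form u (u ∘ D₀.flow t) = Z.form u (u ∘ D.flow t) := by
  -- both states are shift-invariant DLR states at `T = 1`, hence equal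
  have hS₀ : IsShiftInvariant Z₀.μ := by
    have h := (Z₀.measurePreserving_shift 1).map_eq
    rwa [chainShift_one] at h
  have hS : IsShiftInvariant Z.μ := by
    have h := (Z.measurePreserving_shift 1).map_eq
    rwa [chainShift_one] at h
  have hμ : Z₀.μ = Z.μ :=
    OscillatorChain.eq_of_isChainGibbsMeasure_of_isShiftInvariant_pinnedChain 1 hω le_rfl le_rfl one_pos hG₀ hS₀ hG hS
  -- the two flows agree on `bmGood`
  have hflow : ∀ σ ∈ (pinnedChain ω₂ 0 0 1).bmGood, D₀.flow t σ = D.flow t σ := by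
    intro σ hσ
    have h0 : σ ∈ D₀.carrier := by rw [hcar₀]; exact hσ
    have h := D.unique (fun s => D₀.flow s σ) (fun s => by rw [hcar, ← hcar₀]; exact D₀.flow_mem h0 s)
      (D₀.isSolution σ h0) t
    simpa only [D₀.flow_zero σ h0] using h
  have hae : (u ∘ D₀.flow t) =ᵐ[Z₀.μ] (u ∘ D.flow t) := by
    filter_upwards [Z₀.ae_mem_carrier] with σ hσ
    have hσ' : σ ∈ (pinnedChain ω₂ 0 0 1).bmGood := by rw [← hcar₀]; exact hσ
    simp only [comp_apply, hflow σ hσ']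
  calc Z₀.form u (u ∘ D₀.flow t)
      = ∑' x : ℤ, cov[u, (u ∘ D₀.flow t) ∘ chainShift x; Z₀.μ] := Z₀.form_eq_tsum hu₀ (Z₀.comp_flow_mem t hu₀)
    _ = ∑' x : ℤ, cov[u, (u ∘ D.flow t) ∘ chainShift x; Z₀.μ] := by
        refine tsum_congr fun x => covariance_congr_ae_right ?_
        exact (Z₀.measurePreserving_shift x).quasiMeasurePreserving.ae_eq_comp hae
    _ = ∑' x : ℤ, cov[u, (u ∘ D.flow t) ∘ chainShift x; Z.μ] := by rw [hμ]
    _ = Z.form u (u ∘ D.flow t) := (Z.form_eq_tsum hu (Z.comp_flow_mem t hu)).symm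

/-- **Stub K of line `gram-pencil-harmonic-chaos` — the free Fermi-golden-rule kernel of the current** (a theorem: the
composition of the landed sub-stubs K1, K2, KAlg, K6, KΦ, KT; see the module docstring). [cite: AokiLukkarinenSpohn2006, §3] -/
theorem stub_freeForceKernel :
    ∀ ω₂ a b : ℝ, 0 < ω₂ → 0 < a → 0 < b → HasOddSectorGap ω₂ a b →
      ∀ (D₀ : InfiniteChainDynamics (pinnedChain ω₂ 0 0 1)) (Z₀ : ZeroWavenumberData (pinnedChain ω₂ 0 0 1) D₀),
        (pinnedChain ω₂ 0 0 1).IsChainGibbsMeasure 1 Z₀.μ →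
        D₀.carrier = (pinnedChain ω₂ 0 0 1).bmGood →
        Z₀.toFluctuationDynamics.IsStronglyContinuous →
        (fun σ : ChainConfig => liouvilleZ (pinnedChain ω₂ a b 1) (fun σ => (pinnedChain ω₂ 0 0 1).bondCurrentZ σ 0) σ - liouvilleZ (pinnedChain ω₂ 0 0 1) (fun σ => (pinnedChain ω₂ 0 0 1).bondCurrentZ σ 0) σ + b * (liouvilleZ (pinnedChain ω₂ 0 0 1) (fun σ => (pinnedChain ω₂ 0 1 1).bondCurrentZ σ 0) σ - liouvilleZ (pinnedChain ω₂ 0 0 1) (fun σ => (pinnedChain ω₂ 0 0 1).bondCurrentZ σ 0) σ)) ∈ Z₀.localObs →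
        ∃ δ : ℝ, 0 < δ ∧ ∃ ρ : ℝ → ℝ, ContinuousOn ρ (Set.Ioo (-δ) δ) ∧ 0 < ρ 0 ∧
          TendstoLocallyUniformlyOn
            (fun (ν : ℝ) (ω : ℝ) => ∫ t in Set.Ioi (0 : ℝ), Real.exp (-(ν * t)) * (Real.cos (ω * t) *
              Z₀.form
                (fun σ : ChainConfig => liouvilleZ (pinnedChain ω₂ a b 1) (fun σ => (pinnedChain ω₂ 0 0 1).bondCurrentZ σ 0) σ - liouvilleZ (pinnedChain ω₂ 0 0 1) (fun σ => (pinnedChain ω₂ 0 0 1).bondCurrentZ σ 0) σ + b * (liouvilleZ (pinnedChain ω₂ 0 0 1) (fun σ => (pinnedChain ω₂ 0 1 1).bondCurrentZ σ 0) σ - liouvilleZ (pinnedChain ω₂ 0 0 1) (fun σ => (pinnedChain ω₂ 0 0 1).bondCurrentZ σ 0) σ))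
                ((fun σ : ChainConfig => liouvilleZ (pinnedChain ω₂ a b 1) (fun σ => (pinnedChain ω₂ 0 0 1).bondCurrentZ σ 0) σ - liouvilleZ (pinnedChain ω₂ 0 0 1) (fun σ => (pinnedChain ω₂ 0 0 1).bondCurrentZ σ 0) σ + b * (liouvilleZ (pinnedChain ω₂ 0 0 1) (fun σ => (pinnedChain ω₂ 0 1 1).bondCurrentZ σ 0) σ - liouvilleZ (pinnedChain ω₂ 0 0 1) (fun σ => (pinnedChain ω₂ 0 0 1).bondCurrentZ σ 0) σ)) ∘ D₀.flow t)))
            (fun ω => Real.pi * ρ ω) (𝓝[>] (0 : ℝ)) (Set.Ioo (-δ) δ) := by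
  refine stub_freeForceKernel_of_windowDensity ?_
  intro ω₂ a b hω ha hb hgap D₀ Z₀ hG₀ hcar₀ _hsc₀ hΦ₀ m _hm hK
  -- F's canonical datum of the harmonic chain at `T = 1`
  obtain ⟨D, Z, hG, hcar, -, hid, -, -, -, -, hsc, hobs⟩ :=
    stub_pencilFramework
      ω₂ 0 0 hω le_rfl le_rfl
  -- KΦ: the Wick presentation of `Φ` and its kernel identities
  obtain ⟨J, c, f, J', d, g, c₀, hpres, hΨ₂, h22⟩ := stub_forceKernels.2 ω₂ a b hω
  -- KT: the explicit measure and its window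
  obtain ⟨m', hm', hcos, δ, hδ, ρ, hρc, hρ0, hρ00, hw⟩ := stub_forceWindow ω₂ a b hω ha hb hgap J c f h22
  refine ⟨m', hm', fun t => ?_, δ, hδ, ρ, hρc, hρ0, hρ00, hw⟩
  -- K6 on the canonical datum (K2's own K1 premise discharged here); the degree-2 chaos vector is zero (KΦ)
  have hdyn := stub_wickShellDynamic (stub_wickShellStatic stub_harmonicStein) stub_harmonicPencilAlgebra ω₂ hω D Z hG hcar hid hsc hobs J c f J' d g c₀ t
  rw [hΨ₂, add_zero] at hdyn
  rw [hcos t, ← hK t, ← hdyn]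
  -- `Φ = P` as functions
  have hΦP := funext hpres
  rw [← hΦP]
  -- `Φ ∈ 𝒫 ⊆ Z.localObs`
  have hP𝒫 : (fun σ : ChainConfig => (∑ j : Fin J, c j * wick ω₂ 1 4 (f j) σ) + (∑ j : Fin J', d j * wick ω₂ 1 2 (g j) σ) + c₀) ∈
      Algebra.adjoin ℝ (Set.range fun xc : ℤ × Bool => fun σ : ChainConfig => if xc.2 then (σ xc.1).2 else (σ xc.1).1) := by
    set S := Algebra.adjoin ℝ (Set.range fun xc : ℤ × Bool => fun σ : ChainConfig => if xc.2 then (σ xc.1).2 else (σ xc.1).1)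
    have hrepr : (fun σ : ChainConfig => (∑ j : Fin J, c j * wick ω₂ 1 4 (f j) σ) + (∑ j : Fin J', d j * wick ω₂ 1 2 (g j) σ) + c₀) =
        (∑ j : Fin J, c j • wick ω₂ 1 4 (f j)) + (∑ j : Fin J', d j • wick ω₂ 1 2 (g j)) + algebraMap ℝ (ChainConfig → ℝ) c₀ := by
      funext σ
      simp only [Pi.add_apply, Finset.sum_apply, Pi.smul_apply, smul_eq_mul]
      congr 1
    rw [hrepr]
    refine S.add_mem (S.add_mem (S.sum_mem fun j _ => S.smul_mem (stub_harmonicPencilAlgebra.1 ω₂ 1 4 (f j)) _)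
      (S.sum_mem fun j _ => S.smul_mem (stub_harmonicPencilAlgebra.1 ω₂ 1 2 (g j)) _)) (S.algebraMap_mem c₀)
  have hΦ𝒫 : (fun σ : ChainConfig => liouvilleZ (pinnedChain ω₂ a b 1) (fun σ => (pinnedChain ω₂ 0 0 1).bondCurrentZ σ 0) σ - liouvilleZ (pinnedChain ω₂ 0 0 1) (fun σ => (pinnedChain ω₂ 0 0 1).bondCurrentZ σ 0) σ + b * (liouvilleZ (pinnedChain ω₂ 0 0 1) (fun σ => (pinnedChain ω₂ 0 1 1).bondCurrentZ σ 0) σ - liouvilleZ (pinnedChain ω₂ 0 0 1) (fun σ => (pinnedChain ω₂ 0 0 1).bondCurrentZ σ 0) σ)) ∈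
      Algebra.adjoin ℝ (Set.range fun xc : ℤ × Bool => fun σ : ChainConfig => if xc.2 then (σ xc.1).2 else (σ xc.1).1) := by
    rw [hΦP]; exact hP𝒫
  have hflow0 : D.flow 0 = id := by
    funext σ
    by_cases hσ : σ ∈ (pinnedChain ω₂ 0 0 1).bmGood
    · exact D.flow_zero σ (by rw [hcar]; exact hσ)
    · exact hid 0 σ hσ
  have hΦZ : (fun σ : ChainConfig => liouvilleZ (pinnedChain ω₂ a b 1) (fun σ => (pinnedChain ω₂ 0 0 1).bondCurrentZ σ 0) σ - liouvilleZ (pinnedChain ω₂ 0 0 1) (fun σ => (pinnedChain ω₂ 0 0 1).bondCurrentZ σ 0) σ + b * (liouvilleZ (pinnedChain ω₂ 0 0 1) (fun σ => (pinnedChain ω₂ 0 1 1).bondCurrentZ σ 0) σ - liouvilleZ (pinnedChain ω₂ 0 0 1) (fun σ => (pinnedChain ω₂ 0 0 1).bondCurrentZ σ 0) σ)) ∈ Z.localObs := by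
    rw [hobs]
    refine Submodule.subset_span ⟨_, hΦ𝒫, 0, ?_⟩
    rw [hflow0]; rfl
  exact (form_comp_flow_rigid hω Z₀ Z hG₀ hG hcar₀ hcar hΦ₀ hΦZ t).symm

end Summit.AtomisticToContinuum.FouriersLaw.Theorems.DrudeDissolution.GramPencilHarmonicChaos

end
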